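import Literature.NumberTheory.LFunctions.ApproxFunctionalEquation
import Literature.NumberTheory.LFunctions.VinogradovKorobov
import HarnessLib

/-!
# Ford's bound for `ζ(s)`: the crude range (Ford 2002, Lemma 7.1)

Topic `Literature/NumberTheory/LFunctions`. Part of the PROVED deduction "Theorem 2 ⟹ Theorem 1"
of K. Ford, *Vinogradov's integral and bounds for the Riemann zeta function*, Proc. London Math.
Soc. (3) 85 (2002), 565–633 (arXiv:1910.08209) for the named fact
`Literature.NumberTheory.LFunctions.zeta_bound_ford` (`VinogradovKorobov.lean`); see
`FordZetaBoundMain.lean` for the architecture. Everything here is proved; no definitions.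

Lemma 7.1 of the source: for `1/2 ≤ σ ≤ 1`, `t ≥ 3`, and either `σ ≤ 15/16` or `t ≤ 10^{100}`,
`|ζ(s)| ≤ 58.1 t^{4(1−σ)^{3/2}} log^{2/3} t`, from the order-`0` Euler–Maclaurin formula (7.1) at
`N = ⌊t⌋`. We prove the corresponding statement directly with the constants of Theorem 1
(`76.2`, `4.45`) and with the crossover raised from `10^{100}` to `e^{300}` (which the main range
of the in-tree deduction can afford and which gives more room there):

* `FordVK.norm_zeta_le_sum_add` — from the tree's (4.11.2)
  (`AFE.norm_zeta_sub_sum_add_le`, Euler–Maclaurin of order `0`) at `N = ⌊t⌋ + 1`: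
  `|ζ(σ+it)| ≤ ∑_{n ≤ N} n^{−σ} + (11/6) N^{1−σ}` (`t ≥ 3`, `1/2 ≤ σ ≤ 1`);
* `FordVK.sum_rpow_neg_le_log`, `FordVK.sum_rpow_neg_le_div` — `∑_{n ≤ N} n^{−σ} ≤ 1 + N^{1−σ} log N`
  and `≤ 1 + N^{1−σ}/(1−σ)` (integral comparison);
* `FordVK.zeta_bound_ford_of_le_fifteen_sixteenths` — the case `σ ≤ 15/16` (all `t ≥ 3`):
  `|ζ| ≤ 21.6 t^{1−σ} ≤ 76.2 t^{4.45(1−σ)^{3/2}} (log t)^{2/3}`;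
* `FordVK.zeta_bound_ford_of_le_exp_300` — the case `15/16 ≤ σ ≤ 1`, `3 ≤ t ≤ e^{300}`:
  `|ζ| ≤ 1 + 1.0182 t^{1−σ}(log t + 13/6)` and `t^{(1−σ) − 4.45(1−σ)^{3/2}} ≤ t^{1600/213867}`
  (`max_v (v² − 4.45 v³) = 4/(27·4.45²)`), reduced to the one-variable inequality
  `1 + 1.0182 e^{c₀L}(L + 13/6) ≤ 76.2 L^{2/3}` on `1.09 ≤ L ≤ 300`, certified on five segments.

## References

* K. Ford, Proc. London Math. Soc. (3) 85 (2002), 565–633; arXiv:1910.08209 — Lemma 7.1, (7.1),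
  (7.2). (`Ford2002`)
* E. C. Titchmarsh, *The Theory of the Riemann Zeta-Function*, 2nd ed., (4.11.2) (via
  `ApproxFunctionalEquation.lean`).
-/

noncomputable section

open Complex Real

namespace Literature.NumberTheory.LFunctions

namespace FordVK

/-! ## `|ζ(s)|` against `∑ n^{−σ}` -/

/-- Norm of the Dirichlet polynomial `∑_{n ≤ N} n^{−s}` against `∑ n^{−σ}`. [folklore] -/
theorem norm_sum_Icc_cpow_le (σ t : ℝ) (N : ℕ) :
    ‖∑ n ∈ Finset.Icc 1 N, (n : ℂ) ^ (-((σ : ℂ) + t * I))‖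
      ≤ ∑ n ∈ Finset.Icc 1 N, (n : ℝ) ^ (-σ) := by
  refine (norm_sum_le _ _).trans (le_of_eq (Finset.sum_congr rfl fun n hn ↦ ?_))
  have hn : 0 < n := (Finset.mem_Icc.1 hn).1
  rw [Complex.norm_natCast_cpow_of_pos hn]
  simp

/-- **(7.2)-type crude bound.** For `1/2 ≤ σ ≤ 1`, `t ≥ 3` and `N = ⌊t⌋ + 1`,
`|ζ(σ + it)| ≤ ∑_{n ≤ N} n^{−σ} + (11/6) N^{1−σ}`, from (4.11.2):
`‖N^{1−s}/(1−s)‖ ≤ N^{1−σ}/t ≤ N^{1−σ}/3` and `N^{−σ}(1/2 + |s|/(2σ)) ≤ N^{1−σ}(t + 3/2)/t ≤ (3/2)N^{1−σ}`.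
[cite: Ford2002, Lemma 7.1 (proof, (7.1)–(7.2))] -/
theorem norm_zeta_le_sum_add {σ t : ℝ} (ht : 3 ≤ t) (hσ : 1 / 2 ≤ σ) (hσ1 : σ ≤ 1) :
    ‖riemannZeta (σ + t * I)‖
      ≤ (∑ n ∈ Finset.Icc 1 (⌊t⌋₊ + 1), (n : ℝ) ^ (-σ))
        + 11 / 6 * ((⌊t⌋₊ + 1 : ℕ) : ℝ) ^ (1 - σ) := by
  set N : ℕ := ⌊t⌋₊ + 1 with hN
  set s : ℂ := (σ : ℂ) + t * I with hs
  have ht0 : 0 < t := by linarith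
  have hσ0 : 0 < σ := by linarith
  have hsre : s.re = σ := by simp [hs]
  have hsim : s.im = t := by simp [hs]
  have hs1 : s ≠ 1 := by
    intro h; have := congrArg Complex.im h; rw [hsim] at this; simp at this; linarith
  have hN1 : 1 ≤ N := by simp [hN]
  have hNt : t < N := by rw [hN]; push_cast; exact Nat.lt_floor_add_one t
  have hNt' : (N : ℝ) ≤ t + 1 := by
    rw [hN]; push_cast; linarith [Nat.floor_le ht0.le]
  have hN0 : (0 : ℝ) < N := ht0.trans hNt
  have key := AFE.norm_zeta_sub_sum_add_le (s := s) (by rw [hsre]; exact hσ0) hs1 hN1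
  rw [hsre] at key
  -- the three pieces
  have hA := norm_sum_Icc_cpow_le σ t N
  have hB : ‖(N : ℂ) ^ (1 - s) / (1 - s)‖ ≤ (N : ℝ) ^ (1 - σ) / 3 := by
    rw [norm_div, Complex.norm_natCast_cpow_of_pos (by omega : 0 < N)]
    have h1 : (1 - s).re = 1 - σ := by simp [hs]
    rw [h1]
    have h2 : t ≤ ‖1 - s‖ := by
      have := Complex.abs_im_le_norm (1 - s)
      rw [show (1 - s).im = -t by simp [hs], abs_neg, abs_of_pos ht0] at this
      exact this
    have h3 : 0 < ‖1 - s‖ := ht0.trans_le h2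
    exact div_le_div_of_nonneg_left (by positivity) (by norm_num) (ht.trans h2)
  have hC : (N : ℝ) ^ (-σ) * (1 / 2 + ‖s‖ / (2 * σ)) ≤ 3 / 2 * (N : ℝ) ^ (1 - σ) := by
    have h1 : ‖s‖ ≤ 1 + t := by
      calc ‖s‖ ≤ ‖(σ : ℂ)‖ + ‖(t : ℂ) * I‖ := norm_add_le _ _
        _ = σ + t := by
            rw [norm_mul, Complex.norm_I, mul_one, Complex.norm_real, Complex.norm_real,
              Real.norm_eq_abs, Real.norm_eq_abs, abs_of_pos hσ0, abs_of_pos ht0]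
        _ ≤ 1 + t := by linarith
    have h2 : 1 / 2 + ‖s‖ / (2 * σ) ≤ t + 3 / 2 := by
      have : ‖s‖ / (2 * σ) ≤ 1 + t := by
        rw [div_le_iff₀ (by positivity)]; nlinarith [norm_nonneg s]
      linarith
    have h3 : (N : ℝ) ^ (-σ) = (N : ℝ) ^ (1 - σ) / N := by
      rw [Real.rpow_neg hN0.le, Real.rpow_sub hN0, Real.rpow_one]
      field_simp
    rw [h3]
    have h4 : (t + 3 / 2) / N ≤ 3 / 2 := by
      rw [div_le_iff₀ hN0]; nlinarith
    have h5 : 0 ≤ (N : ℝ) ^ (1 - σ) := by positivity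
    calc (N : ℝ) ^ (1 - σ) / N * (1 / 2 + ‖s‖ / (2 * σ))
        ≤ (N : ℝ) ^ (1 - σ) / N * (t + 3 / 2) :=
          mul_le_mul_of_nonneg_left h2 (by positivity)
      _ = (N : ℝ) ^ (1 - σ) * ((t + 3 / 2) / N) := by ring
      _ ≤ (N : ℝ) ^ (1 - σ) * (3 / 2) := mul_le_mul_of_nonneg_left h4 h5
      _ = 3 / 2 * (N : ℝ) ^ (1 - σ) := by ring
  -- assemble
  rw [← hs] at hA
  set Z := riemannZeta s with hZ
  set S := ∑ n ∈ Finset.Icc 1 N, (n : ℂ) ^ (-s) with hS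
  set T := (N : ℂ) ^ (1 - s) / (1 - s) with hT
  have htri : ‖Z‖ ≤ ‖Z - S + T‖ + ‖S‖ + ‖T‖ := by
    have e : Z = (Z - S + T) + (S - T) := by ring
    calc ‖Z‖ = ‖(Z - S + T) + (S - T)‖ := by rw [← e]
      _ ≤ ‖Z - S + T‖ + ‖S - T‖ := norm_add_le _ _
      _ ≤ ‖Z - S + T‖ + (‖S‖ + ‖T‖) := by gcongr; exact norm_sub_le _ _
      _ = _ := by ring
  linarith

/-! ## `∑_{n ≤ N} n^{−σ}` against integrals -/

/-- `∑_{n=1}^{N} n^{−σ} = 1 + ∑_{i ∈ [1, N)} (i+1)^{−σ}`. [folklore] -/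
theorem sum_Icc_rpow_neg_eq (σ : ℝ) {N : ℕ} (hN : 1 ≤ N) :
    ∑ n ∈ Finset.Icc 1 N, (n : ℝ) ^ (-σ)
      = 1 + ∑ i ∈ Finset.Ico 1 N, ((i + 1 : ℕ) : ℝ) ^ (-σ) := by
  rw [← Finset.Ico_add_one_right_eq_Icc, Finset.sum_eq_sum_Ico_succ_bot (by omega), Nat.cast_one,
    Real.one_rpow, Finset.sum_Ico_add' (fun i : ℕ ↦ ((i : ℕ) : ℝ) ^ (-σ)) 1 N 1]

/-- Integral comparison: `∑_{n=1}^{N} n^{−σ} ≤ 1 + ∫_1^N x^{−σ} dx` for `σ ≥ 0`. [folklore] -/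
theorem sum_rpow_neg_le_integral {σ : ℝ} (hσ : 0 ≤ σ) {N : ℕ} (hN : 1 ≤ N) :
    ∑ n ∈ Finset.Icc 1 N, (n : ℝ) ^ (-σ) ≤ 1 + ∫ x in (1 : ℕ)..N, x ^ (-σ) := by
  rw [sum_Icc_rpow_neg_eq σ hN]
  have hanti : AntitoneOn (fun x : ℝ ↦ x ^ (-σ)) (Set.Icc (1 : ℕ) N) := by
    intro x hx y hy hxy
    have hx0 : 0 < x := by have := hx.1; push_cast at this; linarith
    exact Real.rpow_le_rpow_of_nonpos hx0 hxy (by linarith)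
  have := AntitoneOn.sum_le_integral_Ico hN hanti
  linarith

/-- `∑_{n=1}^{N} n^{−σ} ≤ 1 + N^{1−σ} log N` for `0 ≤ σ ≤ 1`. [folklore] -/
theorem sum_rpow_neg_le_log {σ : ℝ} (hσ : 0 ≤ σ) (hσ1 : σ ≤ 1) {N : ℕ} (hN : 1 ≤ N) :
    ∑ n ∈ Finset.Icc 1 N, (n : ℝ) ^ (-σ) ≤ 1 + (N : ℝ) ^ (1 - σ) * Real.log N := by
  have hN0 : (0 : ℝ) < N := by exact_mod_cast hN
  have h1 := sum_rpow_neg_le_integral hσ hN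
  have h2 : ∫ x in ((1 : ℕ) : ℝ)..N, x ^ (-σ) ≤ ∫ x in ((1 : ℕ) : ℝ)..N, (N : ℝ) ^ (1 - σ) * x⁻¹ := by
    have hle : ((1 : ℕ) : ℝ) ≤ N := by exact_mod_cast hN
    refine intervalIntegral.integral_mono_on hle ?_ ?_ ?_
    · refine (ContinuousOn.intervalIntegrable ?_)
      refine ContinuousOn.rpow_const continuousOn_id fun x hx ↦ Or.inl ?_
      rw [Set.uIcc_of_le hle] at hx
      have := hx.1; push_cast at this; exact (by linarith : (0 : ℝ) < x).ne'
    · refine (ContinuousOn.intervalIntegrable ?_)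
      refine ContinuousOn.mul continuousOn_const (continuousOn_inv₀.mono ?_)
      intro x hx
      rw [Set.uIcc_of_le hle] at hx
      have := hx.1; push_cast at this; exact (by linarith : (0 : ℝ) < x).ne'
    · intro x hx
      have hx1 : (1 : ℝ) ≤ x := by have := hx.1; push_cast at this; exact this
      have hx0 : 0 < x := by linarith
      have e : x ^ (-σ) = x ^ (1 - σ) * x⁻¹ := by
        rw [← Real.rpow_neg_one, ← Real.rpow_add hx0]; ring_nf
      rw [e]
      exact mul_le_mul_of_nonneg_right
        (Real.rpow_le_rpow hx0.le hx.2 (by linarith)) (inv_nonneg.2 hx0.le)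
  rw [intervalIntegral.integral_const_mul, integral_inv_of_pos (by norm_num) hN0] at h2
  simp only [Nat.cast_one, div_one] at h1 h2
  linarith

/-- `∑_{n=1}^{N} n^{−σ} ≤ 1 + N^{1−σ}/(1−σ)` for `0 ≤ σ < 1`. [folklore] -/
theorem sum_rpow_neg_le_div {σ : ℝ} (hσ : 0 ≤ σ) (hσ1 : σ < 1) {N : ℕ} (hN : 1 ≤ N) :
    ∑ n ∈ Finset.Icc 1 N, (n : ℝ) ^ (-σ) ≤ 1 + (N : ℝ) ^ (1 - σ) / (1 - σ) := by
  have hN0 : (0 : ℝ) < N := by exact_mod_cast hN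
  have h1 := sum_rpow_neg_le_integral hσ hN
  have h2 : ∫ x in ((1 : ℕ) : ℝ)..N, x ^ (-σ) = ((N : ℝ) ^ (-σ + 1) - 1 ^ (-σ + 1)) / (-σ + 1) := by
    rw [integral_rpow (Or.inl (by linarith))]
    simp
  rw [h2, Real.one_rpow] at h1
  have h3 : ((N : ℝ) ^ (-σ + 1) - 1) / (-σ + 1) ≤ (N : ℝ) ^ (1 - σ) / (1 - σ) := by
    rw [show -σ + 1 = 1 - σ by ring]
    exact div_le_div_of_nonneg_right (by linarith) (by linarith)
  linarith

/-! ## The case `σ ≤ 15/16` -/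

/-- `N^{1−σ} ≤ (4/3)^{1−σ} t^{1−σ}` for `N ≤ t + 1`, `t ≥ 3`. [folklore] -/
theorem rpow_floor_succ_le {σ t : ℝ} (ht : 3 ≤ t) (hσ1 : σ ≤ 1) :
    ((⌊t⌋₊ + 1 : ℕ) : ℝ) ^ (1 - σ) ≤ (4 / 3) ^ (1 - σ) * t ^ (1 - σ) := by
  have ht0 : 0 < t := by linarith
  have hNt' : ((⌊t⌋₊ + 1 : ℕ) : ℝ) ≤ 4 / 3 * t := by
    push_cast; linarith [Nat.floor_le ht0.le]
  rw [← Real.mul_rpow (by norm_num) ht0.le]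
  exact Real.rpow_le_rpow (by positivity) hNt' (by linarith)

/-- **Ford's Theorem 1 in the range `1/2 ≤ σ ≤ 15/16` (all `t ≥ 3`), proved.** Here
`|ζ(σ+it)| ≤ 1 + (16 + 11/6)(4/3)^{1/2} t^{1−σ} ≤ 21.6 t^{1−σ}` and
`t^{1−σ} ≤ t^{4.45(1−σ)^{3/2}}` because `4.45 (1−σ)^{1/2} ≥ 4.45/4 > 1`.
[cite: Ford2002, Lemma 7.1 (case σ ≤ 15/16)] -/
theorem zeta_bound_ford_of_le_fifteen_sixteenths {σ t : ℝ} (ht : 3 ≤ t) (hσ : 1 / 2 ≤ σ)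
    (hσ1 : σ ≤ 15 / 16) :
    ‖riemannZeta (σ + t * I)‖
      ≤ 76.2 * t ^ (4.45 * (1 - σ) ^ (3 / 2 : ℝ)) * Real.log t ^ (2 / 3 : ℝ) := by
  have ht0 : 0 < t := by linarith
  have ht1 : 1 ≤ t := by linarith
  have h0 := norm_zeta_le_sum_add ht hσ (by linarith)
  set N : ℕ := ⌊t⌋₊ + 1 with hN
  have hN1 : 1 ≤ N := by simp [hN]
  have h1 := sum_rpow_neg_le_div (by linarith : 0 ≤ σ) (by linarith) hN1
  have h2 := rpow_floor_succ_le ht (by linarith : σ ≤ 1)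
  rw [← hN] at h2
  -- `(4/3)^{1-σ} ≤ (4/3)^{1/2} ≤ 1.1548`
  have h3 : (4 / 3 : ℝ) ^ (1 - σ) ≤ 1.1548 := by
    have : (4 / 3 : ℝ) ^ (1 - σ) ≤ (4 / 3 : ℝ) ^ (1 / 2 : ℝ) :=
      Real.rpow_le_rpow_of_exponent_le (by norm_num) (by linarith)
    refine this.trans ?_
    rw [← Real.sqrt_eq_rpow, Real.sqrt_le_left (by norm_num)]
    norm_num
  have hX0 : 0 ≤ t ^ (1 - σ) := by positivity
  have hNle : (N : ℝ) ^ (1 - σ) ≤ 1.1548 * t ^ (1 - σ) := h2.trans (by nlinarith)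
  -- `1/(1-σ) ≤ 16`
  have h4 : (N : ℝ) ^ (1 - σ) / (1 - σ) ≤ 16 * (N : ℝ) ^ (1 - σ) := by
    rw [div_le_iff₀ (by linarith)]
    have : 0 ≤ (N : ℝ) ^ (1 - σ) := by positivity
    nlinarith
  -- `t^{1-σ} ≥ 1`
  have h5 : 1 ≤ t ^ (1 - σ) := Real.one_le_rpow ht1 (by linarith)
  have hζ : ‖riemannZeta (σ + t * I)‖ ≤ 21.6 * t ^ (1 - σ) := by
    have : ‖riemannZeta (σ + t * I)‖ ≤ 1 + (16 + 11 / 6) * (N : ℝ) ^ (1 - σ) := by linarith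
    nlinarith
  -- exponents: `1 - σ ≤ 4.45 (1-σ)^{3/2}`
  have h6 : t ^ (1 - σ) ≤ t ^ (4.45 * (1 - σ) ^ (3 / 2 : ℝ)) := by
    apply Real.rpow_le_rpow_of_exponent_le ht1
    have hv : (1 : ℝ) / 16 ≤ 1 - σ := by linarith
    have hv0 : 0 < 1 - σ := by linarith
    have e : (1 - σ) ^ (3 / 2 : ℝ) = (1 - σ) * (1 - σ) ^ (1 / 2 : ℝ) := by
      rw [show (3 / 2 : ℝ) = 1 + 1 / 2 by norm_num, Real.rpow_add hv0, Real.rpow_one]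
    have hsq : (1 : ℝ) / 4 ≤ (1 - σ) ^ (1 / 2 : ℝ) := by
      rw [← Real.sqrt_eq_rpow, Real.le_sqrt (by norm_num) hv0.le]
      linarith
    rw [e]
    nlinarith
  have h7 : 1 ≤ Real.log t ^ (2 / 3 : ℝ) := by
    apply Real.one_le_rpow _ (by norm_num)
    exact le_trans (by norm_num) (VK.log_three_ge.trans (Real.log_le_log (by norm_num) ht))
  have h8 : 0 ≤ t ^ (4.45 * (1 - σ) ^ (3 / 2 : ℝ)) := by positivity
  calc ‖riemannZeta (σ + t * I)‖ ≤ 21.6 * t ^ (1 - σ) := hζ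
    _ ≤ 76.2 * t ^ (4.45 * (1 - σ) ^ (3 / 2 : ℝ)) * 1 := by linarith
    _ ≤ 76.2 * t ^ (4.45 * (1 - σ) ^ (3 / 2 : ℝ)) * Real.log t ^ (2 / 3 : ℝ) :=
        mul_le_mul_of_nonneg_left h7 (by positivity)

/-! ## The case `15/16 ≤ σ ≤ 1`, `t ≤ e^{300}` -/

/-- The exponent comparison of the crude range: for `0 ≤ 1 − σ`,
`(1 − σ) − 4.45 (1 − σ)^{3/2} ≤ 1600/213867 = 4/(27 · 4.45²)` (maximum at `(1−σ)^{1/2} = 40/267`;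
`4.45 v³ − v² + 1600/213867 = 4.45 (v − 40/267)² (v + 20/267)`). [folklore] -/
theorem sub_rpow_three_halves_le {σ : ℝ} (hσ1 : σ ≤ 1) :
    (1 - σ) - 4.45 * (1 - σ) ^ (3 / 2 : ℝ) ≤ 1600 / 213867 := by
  have h0 : 0 ≤ 1 - σ := by linarith
  set v : ℝ := (1 - σ) ^ (1 / 2 : ℝ) with hv
  have hv0 : 0 ≤ v := by rw [hv]; positivity
  have e2 : (1 - σ) = v ^ 2 := by
    rw [hv, ← Real.rpow_natCast, ← Real.rpow_mul h0]; norm_num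
  have e3 : (1 - σ) ^ (3 / 2 : ℝ) = v ^ 3 := by
    rw [hv, ← Real.rpow_natCast, ← Real.rpow_mul h0]; norm_num
  rw [e3]; rw [e2]
  nlinarith [mul_nonneg (mul_nonneg (by norm_num : (0 : ℝ) ≤ 4.45) (sq_nonneg (v - 40 / 267)))
    (by linarith : (0 : ℝ) ≤ v + 20 / 267)]

/-- One segment of the one-variable inequality of the crude range: on `L₀ ≤ L ≤ L₁`,
`1 + 1.0182 e^{c₀L}(L + 13/6) ≤ 76.2 L^{2/3}` from `e^{c₀L₁} ≤ E` (as `exp (k + f) ≤ E`,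
`k + f = c₀ L₁`), `r³ ≤ L₀²` and `1 + 1.0182 E (L₁ + 13/6) ≤ 76.2 r`. [folklore] -/
theorem crude_segment {L L₀ L₁ E r f : ℝ} {k : ℕ} (hL₀ : 0 < L₀) (h0 : L₀ ≤ L) (h1 : L ≤ L₁)
    (hkf : (k : ℝ) + f = 1600 / 213867 * L₁) (hf0 : 0 ≤ f) (hf1 : f ≤ 1)
    (hE : VK.expUB k f ≤ E) (hr3 : r ^ 3 ≤ L₀ ^ 2)
    (hnum : 1 + 1.0182 * E * (L₁ + 13 / 6) ≤ 76.2 * r) :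
    1 + 1.0182 * Real.exp (1600 / 213867 * L) * (L + 13 / 6) ≤ 76.2 * L ^ (2 / 3 : ℝ) := by
  have hL : 0 < L := hL₀.trans_le h0
  have hexp : Real.exp (1600 / 213867 * L) ≤ E := by
    have h := VK.exp_le_of_expUB_le hf0 hf1 hE
    rw [hkf] at h
    exact (Real.exp_le_exp.2 (by nlinarith)).trans h
  have hr' : r ≤ L ^ (2 / 3 : ℝ) := by
    refine le_of_pow_le_pow_left₀ (n := 3) (by norm_num) (by positivity) ?_
    rw [VK.rpow_two_thirds_pow_three hL.le]
    exact hr3.trans (pow_le_pow_left₀ hL₀.le h0 2)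
  have hE0 : 0 ≤ E := (Real.exp_pos _).le.trans hexp
  have h2 : Real.exp (1600 / 213867 * L) * (L + 13 / 6) ≤ E * (L₁ + 13 / 6) :=
    mul_le_mul hexp (by linarith) (by linarith) hE0
  nlinarith

/-- The one-variable inequality of the crude range: for `1.09 ≤ L ≤ 300`,
`1 + 1.0182 e^{1600 L/213867}(L + 13/6) ≤ 76.2 L^{2/3}` (five certified segments; the binding
one is `[262, 300]`, with a `7 %` margin). [folklore] -/
theorem crude_numerics {L : ℝ} (h0 : 1.09 ≤ L) (h1 : L ≤ 300) :
    1 + 1.0182 * Real.exp (1600 / 213867 * L) * (L + 13 / 6) ≤ 76.2 * L ^ (2 / 3 : ℝ) := by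
  rcases le_or_gt L 10 with hA | hA
  · exact crude_segment (L₀ := 1.09) (L₁ := 10) (k := 0) (f := 16000 / 213867) (E := 1.078)
      (r := 1.059) (by norm_num) h0 hA (by norm_num) (by norm_num) (by norm_num)
      (by norm_num [VK.expUB]) (by norm_num) (by norm_num)
  rcases le_or_gt L 60 with hB | hB
  · exact crude_segment (L₀ := 10) (L₁ := 60) (k := 0) (f := 96000 / 213867) (E := 1.567)
      (r := 4.64) (by norm_num) hA.le hB (by norm_num) (by norm_num) (by norm_num)
      (by norm_num [VK.expUB]) (by norm_num) (by norm_num)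
  rcases le_or_gt L 200 with hC | hC
  · exact crude_segment (L₀ := 60) (L₁ := 200) (k := 1) (f := 320000 / 213867 - 1) (E := 4.465)
      (r := 15.32) (by norm_num) hB.le hC (by norm_num) (by norm_num) (by norm_num)
      (by norm_num [VK.expUB]) (by norm_num) (by norm_num)
  rcases le_or_gt L 262 with hD | hD
  · exact crude_segment (L₀ := 200) (L₁ := 262) (k := 1) (f := 419200 / 213867 - 1) (E := 7.101)
      (r := 34.19) (by norm_num) hC.le hD (by norm_num) (by norm_num) (by norm_num)
      (by norm_num [VK.expUB]) (by norm_num) (by norm_num)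
  · exact crude_segment (L₀ := 262) (L₁ := 300) (k := 2) (f := 480000 / 213867 - 2) (E := 9.435)
      (r := 40.94) (by norm_num) hD.le h1 (by norm_num) (by norm_num) (by norm_num)
      (by norm_num [VK.expUB]) (by norm_num) (by norm_num)

/-- `(4/3)^{1/16} ≤ 1.0182`. [folklore] -/
theorem four_thirds_rpow_sixteenth_le : (4 / 3 : ℝ) ^ (1 / 16 : ℝ) ≤ 1.0182 := by
  refine le_of_pow_le_pow_left₀ (n := 16) (by norm_num) (by norm_num) ?_
  rw [← Real.rpow_natCast, ← Real.rpow_mul (by norm_num)]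
  norm_num

/-- **Ford's Theorem 1 in the range `15/16 ≤ σ ≤ 1`, `3 ≤ t ≤ e^{300}`, proved.** Here
`|ζ(σ+it)| ≤ 1 + 1.0182 t^{1−σ} (log t + 13/6)`, `t^{1−σ} ≤ t^{1600/213867} t^{4.45(1−σ)^{3/2}}`,
and the one-variable inequality `FordVK.crude_numerics` in `L = log t ≤ 300`. (The source's
Lemma 7.1 covers `t ≤ 10^{100}` with the constants `58.1`, `4`; the crossover `e^{300}` is the
in-tree choice.) [cite: Ford2002, Lemma 7.1 (case t ≤ 10^100)] -/
theorem zeta_bound_ford_of_le_exp_300 {σ t : ℝ} (ht : 3 ≤ t) (ht' : t ≤ Real.exp 300)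
    (hσ : 15 / 16 ≤ σ) (hσ1 : σ ≤ 1) :
    ‖riemannZeta (σ + t * I)‖
      ≤ 76.2 * t ^ (4.45 * (1 - σ) ^ (3 / 2 : ℝ)) * Real.log t ^ (2 / 3 : ℝ) := by
  have ht0 : 0 < t := by linarith
  have ht1 : 1 ≤ t := by linarith
  have h0 := norm_zeta_le_sum_add ht (by linarith) hσ1
  set N : ℕ := ⌊t⌋₊ + 1 with hN
  have hN1 : 1 ≤ N := by simp [hN]
  have hN0 : (0 : ℝ) < N := by exact_mod_cast hN1
  have hNt' : (N : ℝ) ≤ t + 1 := by rw [hN]; push_cast; linarith [Nat.floor_le ht0.le]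
  have h1 := sum_rpow_neg_le_log (by linarith : 0 ≤ σ) hσ1 hN1
  set L : ℝ := Real.log t with hL
  have hL3 : 1.09 ≤ L := VK.log_three_ge.trans (Real.log_le_log (by norm_num) ht)
  have hL300 : L ≤ 300 := by
    rw [hL, Real.log_le_iff_le_exp ht0]; exact ht'
  -- `log N ≤ L + 1/3`
  have hlogN : Real.log N ≤ L + 1 / 3 := by
    have e : t + 1 = t * (1 + 1 / t) := by field_simp
    have h2 : Real.log N ≤ Real.log (t + 1) := Real.log_le_log hN0 hNt'
    have h3 : Real.log (t + 1) = L + Real.log (1 + 1 / t) := by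
      rw [e, Real.log_mul ht0.ne' (by positivity), hL]
    have h4 : Real.log (1 + 1 / t) ≤ 1 / t := by
      have := Real.log_le_sub_one_of_pos (by positivity : (0 : ℝ) < 1 + 1 / t); linarith
    have h5 : 1 / t ≤ 1 / 3 := one_div_le_one_div_of_le (by norm_num) ht
    linarith
  -- `N^{1-σ} ≤ 1.0182 t^{1-σ}`
  have hNpow : (N : ℝ) ^ (1 - σ) ≤ 1.0182 * t ^ (1 - σ) := by
    have h2 := rpow_floor_succ_le ht hσ1
    rw [← hN] at h2
    have h3 : (4 / 3 : ℝ) ^ (1 - σ) ≤ 1.0182 :=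
      (Real.rpow_le_rpow_of_exponent_le (by norm_num) (by linarith)).trans
        four_thirds_rpow_sixteenth_le
    have h4 : 0 ≤ t ^ (1 - σ) := by positivity
    nlinarith
  -- hence `|ζ| ≤ 1 + 1.0182 t^{1-σ} (L + 13/6)`
  have hlogN0 : 0 ≤ Real.log N := Real.log_nonneg (by exact_mod_cast hN1)
  have hζ : ‖riemannZeta (σ + t * I)‖ ≤ 1 + 1.0182 * t ^ (1 - σ) * (L + 13 / 6) := by
    have h2 : ‖riemannZeta (σ + t * I)‖ ≤ 1 + (N : ℝ) ^ (1 - σ) * (Real.log N + 11 / 6) := by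
      linarith
    have h3 : (N : ℝ) ^ (1 - σ) * (Real.log N + 11 / 6) ≤ (1.0182 * t ^ (1 - σ)) * (L + 13 / 6) :=
      mul_le_mul hNpow (by linarith) (by linarith) (by positivity)
    linarith
  -- exponent comparison: `t^{1-σ} ≤ e^{c₀ L} t^{B''}`
  set B'' : ℝ := 4.45 * (1 - σ) ^ (3 / 2 : ℝ) with hB''
  have hB0 : 0 ≤ B'' := by rw [hB'']; positivity
  have htpow : t ^ (1 - σ) ≤ Real.exp (1600 / 213867 * L) * t ^ B'' := by
    have e : 1 - σ = ((1 - σ) - B'') + B'' := by ring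
    rw [e, Real.rpow_add ht0]
    refine mul_le_mul_of_nonneg_right ?_ (by positivity)
    have h2 : (1 - σ) - B'' ≤ 1600 / 213867 := by rw [hB'']; exact sub_rpow_three_halves_le hσ1
    calc t ^ ((1 - σ) - B'') ≤ t ^ (1600 / 213867 : ℝ) := Real.rpow_le_rpow_of_exponent_le ht1 h2
      _ = Real.exp (1600 / 213867 * L) := by
          rw [Real.rpow_def_of_pos ht0, hL]; ring_nf
  have htB : 1 ≤ t ^ B'' := Real.one_le_rpow ht1 hB0
  have hG := crude_numerics hL3 hL300
  have hE0 : 0 ≤ Real.exp (1600 / 213867 * L) := (Real.exp_pos _).le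
  have hL0 : 0 ≤ L + 13 / 6 := by linarith
  -- assemble
  calc ‖riemannZeta (σ + t * I)‖ ≤ 1 + 1.0182 * t ^ (1 - σ) * (L + 13 / 6) := hζ
    _ ≤ 1 + 1.0182 * (Real.exp (1600 / 213867 * L) * t ^ B'') * (L + 13 / 6) := by
        gcongr
    _ ≤ t ^ B'' * (1 + 1.0182 * Real.exp (1600 / 213867 * L) * (L + 13 / 6)) := by
        nlinarith [mul_nonneg hE0 hL0]
    _ ≤ t ^ B'' * (76.2 * L ^ (2 / 3 : ℝ)) := mul_le_mul_of_nonneg_left hG (by positivity)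
    _ = 76.2 * t ^ B'' * L ^ (2 / 3 : ℝ) := by ring

/-- **The crude range of Ford's Theorem 1, proved** (Lemma 7.1 of the source with the crossover
`e^{300}` and the constants of Theorem 1): for `1/2 ≤ σ ≤ 1`, `t ≥ 3`, and `σ ≤ 15/16` or
`t ≤ e^{300}`, `|ζ(σ + it)| ≤ 76.2 t^{4.45(1−σ)^{3/2}} (log t)^{2/3}`.
[cite: Ford2002, Lemma 7.1] -/
theorem zeta_bound_ford_crude {σ t : ℝ} (ht : 3 ≤ t) (hσ : 1 / 2 ≤ σ) (hσ1 : σ ≤ 1)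
    (h : σ ≤ 15 / 16 ∨ t ≤ Real.exp 300) :
    ‖riemannZeta (σ + t * I)‖
      ≤ 76.2 * t ^ (4.45 * (1 - σ) ^ (3 / 2 : ℝ)) * Real.log t ^ (2 / 3 : ℝ) := by
  rcases le_or_gt σ (15 / 16) with h1 | h1
  · exact zeta_bound_ford_of_le_fifteen_sixteenths ht hσ h1
  · rcases h with h | h
    · exact absurd h (not_le.2 h1)
    · exact zeta_bound_ford_of_le_exp_300 ht h h1.le hσ1

end FordVK

end Literature.NumberTheory.LFunctions
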